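import Summits.ABC.IUTFork.ForkPacketHullVolumeWindow
import Literature.IUT.LogVolume.TensorPacketTameShell
import Literature.IUT.LogVolume.TensorPacketShellDefect
import HarnessLib

/-!
# The Θ-hull volume at a TAME real summand: closed form `−m·log p + b_I·log p` and the window
# `[log‖t_{v_j}‖ − log μ̄(R_I), log‖t_{v_{i₀}}‖ − log μ̄(R_I) + {d_I + 1}·log p]`
# (sequel to `ForkPacketHullVolumeWindow`; [IUTchIV] Prop. 1.1, 1.2 (i), 1.4 (iii); Dupuy–Hilado §4.12)

Record-only companion (abc-iut cell, prover seat abc-iut-w5-d082, item XXVIIc-window of `HOME/skel/FORK-REAL-MODEL.md` §4).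
At a summand `v⃗ = e` of c312-3's `realPrimePacket p 𝔽` ALL of whose slots are TAME (`p > 2`, `e(K_{v̲_i}) ≤ p − 2`), the
two packet invariants of the volume-form window are classical numbers (`Literature.IUT.LogVolume.TensorPacketShellHull`,
`TensorPacketTameShell`): `H = log μ̄(hull(log_p(R_I^×))) = b_I·log p = −(Σ_i 1/e_i)·log p` and
`δ_Λ = −log μ̄(R_I) ∈ [0, (d_I − d_*)·log p]`, the normalisation defect of `R_I = ⊗_{ℤ_p} R_i`. Hence, for every sharp
(Ind3)-datum around theta values `t` (hypotheses `hB`/`hB1` of XXVI's `thetaHull_bound`):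

* `logμ_thetaHull_eq_of_tame`: **`log μ̄(Θ-hull at v⃗) = −m·log p + b_I·log p`** for the content `m` of the (Ind1)-union
  (abc-iut-w5-d180's `thetaHull_eq_packetHull_zpow_logPacket` with `H` evaluated);
* `logμ_thetaHull_window_of_tame`:
  **`log‖t_{v_j}‖ − log μ̄(R_I) ≤ log μ̄(Θ-hull at v⃗) ≤ log‖t_{v_{i₀}}‖ − log μ̄(R_I) + {d_I + 1}·log p`**;
* at the tame DIAGONAL summand with the printed Θ-weights `‖t_v‖ = ‖q̲‖^{j²}`: R0 HOLDS if
  `(j² − 1)·(−log‖q̲‖) ≤ −log μ̄(R_I)` (`volumeReading_thetaWeights_of_le_of_tame`) and R0, R2, R3, R4, R4′ all FAIL if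
  `(j² − 1)·(−log‖q̲‖) > −log μ̄(R_I) + {d_I + 1}·log p` (`readings_fail_thetaWeights_of_gt_of_tame`) — the summand threshold
  pinned to a window of width `{d_I + 1}·log p` (`d_i = (e_i − 1)/e_i < 1` at tame slots) located at `−log μ̄(R_I)`.

Also, at ANY summand (no tameness): `logμ_thetaHull_window_explicit` — the window of `ForkPacketHullVolumeWindow` with `δ_Λ`
written out via `TensorPacketShellDefect` as `Σ_i {log‖z_i^max‖ + (1/e_i + m_i/(e_i f_i))·log p} − log μ̄(R_I)` (`z_i^max` any
per-factor norm-maximisers of the `log_p(R_i^×)`, `p^{m_i} = #μ_{p^∞}(K_{v̲_i})`): every term is a classical per-field constant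
except the normalisation defect `−log μ̄(R_I)` of `R_I = ⊗_{ℤ_p} O_{K_{v̲_i}}`.

HONEST SCOPE as in XXVI / `ForkPacketHullVolumeWindow`: summand level, sharp (Ind3), nothing about the GLOBAL
`Cor312.Setting.Statement`; (Ind2)/hull/orbit are the tree's typings of disputed-corpus constructions
[claim: Mochizuki2012, status: disputed]; the algebra is classical [cite: Mochizuki2012, IUTchIV Prop. 1.1 p. 9, Prop. 1.2
(i) p. 10, Prop. 1.4 (iii) p. 13] [cite: DupuyHilado2025, §4.9, §4.12]. typed ≠ proved; no side taken on [IUTchIII]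
Cor. 3.12. PROOF-ONLY file: no definitions, no named `Prop` facts.
-/

noncomputable section

open Set Literature.IUT.LogVolume
open scoped Pointwise

namespace Summit.ABC.IUTFork.PacketReal

variable {F : Type} [Field F] [NumberField F]
variable (p : ℕ) [Fact p.Prime] (𝔽 : LocalFields F p)

/-! ## Any summand: the window with `δ_Λ` written in classical invariants -/

/-- **The volume-form window with the hull defect written out**: for every sharp (Ind3)-datum around `t` (`j ≥ 1`,
`I* ⊇` the non-tame slots, `i₀` a slot of largest norm) and ANY family `z` of per-factor norm-maximisers of the
`log_p(R_i^×)`, writing `D := Σ_i {log‖z_i‖ + (1/e_i + m_i/(e_i f_i))·log p} − log μ̄(R_I)` (`= δ_Λ`):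
`log‖t_{v_j}‖ + D ≤ log μ̄(Θ-hull at v⃗) ≤ log‖t_{v_{i₀}}‖ + D + {d_I + 1 + 4|I*|/p}·log p`.
[cite: Mochizuki2012, IUTchIV Prop. 1.4 (ii)(iii) p. 13] [cite: DupuyHilado2025, §4.9, §4.12] -/
theorem logμ_thetaHull_window_explicit {j : ℕ} (hj : 1 ≤ j) (e : Fin (j + 1) → placesOver F p)
    (t : ∀ v : placesOver F p, (𝔽.k v)ˣ) (B : (realPrimePacket p 𝔽).Region)
    (hB : ∀ σ : Equiv.Perm (Fin (j + 1)), B j (e ∘ σ) ⊆ pilotRegion p 𝔽 (e ∘ σ) (t (e (σ (Fin.last j)))))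
    (hB1 : pilotRegion p 𝔽 e (t (e (Fin.last j))) ⊆ B j e)
    (Istar : Finset (Fin (j + 1))) (htame : ∀ i, i ∉ Istar → absRamificationIdx p (𝔽.k (e i)) ≤ p - 2)
    (i₀ : Fin (j + 1)) (hmax : ∀ i, ‖(t (e i) : 𝔽.k (e i))‖ ≤ ‖(t (e i₀) : 𝔽.k (e i₀))‖)
    {z : ∀ i : Fin (j + 1), 𝔽.k (e i)} (hzmem : ∀ i, z i ∈ logUnits (𝔽.k (e i)))
    (hz : ∀ i, ∀ w ∈ logUnits (𝔽.k (e i)), ‖w‖ ≤ ‖z i‖) :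
    Real.log ‖(t (e (Fin.last j)) : 𝔽.k (e (Fin.last j)))‖ +
          ((∑ i, (Real.log ‖z i‖ + (1 / (absRamificationIdx p (𝔽.k (e i)) : ℝ) +
              (torsionPExp p (𝔽.k (e i)) : ℝ) /
                ((absRamificationIdx p (𝔽.k (e i)) : ℝ) * residueDegree p (𝔽.k (e i)))) * Real.log p)) -
            packetLogμ p (fun i => 𝔽.k (e i)) (integerPacket p (fun i => 𝔽.k (e i)) : Set _)) ≤
        (realPrimePacket p 𝔽).logμ (thetaHull p 𝔽 e B) ∧
      (realPrimePacket p 𝔽).logμ (thetaHull p 𝔽 e B) ≤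
        Real.log ‖(t (e i₀) : 𝔽.k (e i₀))‖ +
            ((∑ i, (Real.log ‖z i‖ + (1 / (absRamificationIdx p (𝔽.k (e i)) : ℝ) +
                (torsionPExp p (𝔽.k (e i)) : ℝ) /
                  ((absRamificationIdx p (𝔽.k (e i)) : ℝ) * residueDegree p (𝔽.k (e i)))) * Real.log p)) -
              packetLogμ p (fun i => 𝔽.k (e i)) (integerPacket p (fun i => 𝔽.k (e i)) : Set _)) +
          (dSum p (fun i => 𝔽.k (e i)) + 1 + 4 * (Istar.card : ℝ) / p) * Real.log p := by
  haveI : Nonempty (Fin (j + 1)) := ⟨0⟩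
  have hδ := packetLogμ_packetHull_logPacket_sub_eq p (fun i => 𝔽.k (e i)) hzmem hz
  obtain ⟨hlo, hup⟩ := logμ_thetaHull_window p 𝔽 hj e t B hB hB1 Istar htame i₀ hmax
  rw [hδ] at hlo hup
  exact ⟨hlo, hup⟩

section Tame

variable {p 𝔽}
variable (hp : 2 < p) {j : ℕ} (e : Fin (j + 1) → placesOver F p)
  (he : ∀ i, absRamificationIdx p (𝔽.k (e i)) ≤ p - 2)
  (t : ∀ v : placesOver F p, (𝔽.k v)ˣ) (B : (realPrimePacket p 𝔽).Region)
  (hB : ∀ σ : Equiv.Perm (Fin (j + 1)), B j (e ∘ σ) ⊆ pilotRegion p 𝔽 (e ∘ σ) (t (e (σ (Fin.last j)))))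
  (hB1 : pilotRegion p 𝔽 e (t (e (Fin.last j))) ⊆ B j e)
include hp he hB hB1

/-- **Tame summand, exact**: `log μ̄(Θ-hull at v⃗) = −m·log p + b_I·log p` for the content `m` of the (Ind1)-union of
the sharp data (`M ⊆ p^m·Λ`, `M ⊄ p^{m+1}·Λ`). [cite: DupuyHilado2025, §4.9, §4.12] [cite: Mochizuki2012, IUTchIV Prop. 1.2 (i) p. 10] -/
theorem logμ_thetaHull_eq_of_tame :
    ∃ m : ℤ,
      (⋃ σ : Equiv.Perm (Fin (j + 1)), (realPrimePacket p 𝔽).perm σ e '' B j (e ∘ σ)) ⊆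
          ((p : ℚ_[p]) ^ m) • (logPacket p (fun i => 𝔽.k (e i)) : Set (PacketAlgebra p (fun i => 𝔽.k (e i)))) ∧
      ¬ (⋃ σ : Equiv.Perm (Fin (j + 1)), (realPrimePacket p 𝔽).perm σ e '' B j (e ∘ σ)) ⊆
          ((p : ℚ_[p]) ^ (m + 1)) •
            (logPacket p (fun i => 𝔽.k (e i)) : Set (PacketAlgebra p (fun i => 𝔽.k (e i)))) ∧
      (realPrimePacket p 𝔽).logμ (thetaHull p 𝔽 e B) =
        -(m * Real.log p) + bSum p (fun i => 𝔽.k (e i)) * Real.log p := by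
  haveI : Nonempty (Fin (j + 1)) := ⟨0⟩
  obtain ⟨m, hm, hm1, -, -, hvol⟩ := thetaHull_eq_packetHull_zpow_logPacket p 𝔽 e t B hB hB1
  refine ⟨m, hm, hm1, ?_⟩
  rw [hvol, packetLogμ_packetHull_logPacket_eq_bSum_of_tame p (fun i => 𝔽.k (e i)) hp he]

/-- **Tame summand, window**: `log‖t_{v_j}‖ − log μ̄(R_I) ≤ log μ̄(Θ-hull at v⃗) ≤ log‖t_{v_{i₀}}‖ − log μ̄(R_I) +
{d_I + 1}·log p` (`j ≥ 1`, `i₀` a slot of largest norm; `−log μ̄(R_I) ≥ 0` the normalisation defect of `R_I`).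
[cite: Mochizuki2012, IUTchIV Prop. 1.4 (iii) p. 13] [cite: DupuyHilado2025, §4.9, §4.12] -/
theorem logμ_thetaHull_window_of_tame (hj : 1 ≤ j)
    (i₀ : Fin (j + 1)) (hmax : ∀ i, ‖(t (e i) : 𝔽.k (e i))‖ ≤ ‖(t (e i₀) : 𝔽.k (e i₀))‖) :
    Real.log ‖(t (e (Fin.last j)) : 𝔽.k (e (Fin.last j)))‖ -
          packetLogμ p (fun i => 𝔽.k (e i)) (integerPacket p (fun i => 𝔽.k (e i)) : Set _) ≤
        (realPrimePacket p 𝔽).logμ (thetaHull p 𝔽 e B) ∧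
      (realPrimePacket p 𝔽).logμ (thetaHull p 𝔽 e B) ≤
        Real.log ‖(t (e i₀) : 𝔽.k (e i₀))‖ -
            packetLogμ p (fun i => 𝔽.k (e i)) (integerPacket p (fun i => 𝔽.k (e i)) : Set _) +
          (dSum p (fun i => 𝔽.k (e i)) + 1) * Real.log p := by
  haveI : Nonempty (Fin (j + 1)) := ⟨0⟩
  have hδ := packetLogμ_packetHull_logPacket_sub_eq_of_tame p (fun i => 𝔽.k (e i)) hp he
  have hlo := logμ_thetaHull_ge_defect p 𝔽 e t B hB hB1
  have hup := logμ_thetaHull_le_first p 𝔽 hj e t B hB hB1 ∅ (fun i _ => he i) i₀ hmax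
  rw [Finset.card_empty, Nat.cast_zero, mul_zero, zero_div, add_zero] at hup
  rw [hδ] at hlo hup
  exact ⟨by linarith, by linarith⟩

end Tame

/-! ## The tame diagonal summand: the R0 threshold sits at `−log μ̄(R_I)` up to `{d_I + 1}·log p` -/

section TameDiagonal

variable {p 𝔽}
variable (hp : 2 < p) {j : ℕ} (v : placesOver F p) (he : absRamificationIdx p (𝔽.k v) ≤ p - 2)
  (t : ∀ w : placesOver F p, (𝔽.k w)ˣ) (q : (𝔽.k v)ˣ)
  (hθ : ‖(t v : 𝔽.k v)‖ = ‖(q : 𝔽.k v)‖ ^ (j ^ 2))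
  (B : (realPrimePacket p 𝔽).Region)
  (hB : ∀ σ : Equiv.Perm (Fin (j + 1)),
    B j ((fun _ : Fin (j + 1) => v) ∘ σ) ⊆ pilotRegion p 𝔽 ((fun _ : Fin (j + 1) => v) ∘ σ) (t v))
  (hB1 : pilotRegion p 𝔽 (fun _ : Fin (j + 1) => v) (t v) ⊆ B j (fun _ => v))
include hp he hθ hB hB1

/-- **R0 HOLDS at a tame diagonal summand as soon as `(j² − 1)·(−log‖q̲‖) ≤ −log μ̄(R_I)`** (Θ-weights
`‖t_v‖ = ‖q̲‖^{j²}`; every sharp (Ind3)-datum). [cite: Mochizuki2012, IUTchIV Thm 1.10 proof Step (v) p. 27–28]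
[cite: DupuyHilado2025, §4.12] -/
theorem volumeReading_thetaWeights_of_le_of_tame
    (hle : ((j : ℝ) ^ 2 - 1) * (-Real.log ‖(q : 𝔽.k v)‖) ≤
      -packetLogμ p (fun _ : Fin (j + 1) => 𝔽.k v) (integerPacket p (fun _ : Fin (j + 1) => 𝔽.k v) : Set _)) :
    VolumeReading p 𝔽 (fun _ : Fin (j + 1) => v) q B := by
  haveI : Nonempty (Fin (j + 1)) := ⟨0⟩
  have hδ := packetLogμ_packetHull_logPacket_sub_eq_of_tame p (fun _ : Fin (j + 1) => 𝔽.k v) hp (fun _ => he)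
  refine volumeReading_thetaWeights_of_le_defect v t q hθ B hB hB1 ?_
  rw [hδ]
  exact hle

/-- **R0, R2, R3, R4, R4′ all FAIL at a tame diagonal summand as soon as `(j² − 1)·(−log‖q̲‖) > −log μ̄(R_I) +
{d_I + 1}·log p`** (`j ≥ 1`). With `volumeReading_thetaWeights_of_le_of_tame`: the exact threshold for
`(j² − 1)·(−log‖q̲‖)` lies in `[−log μ̄(R_I), −log μ̄(R_I) + {d_I + 1}·log p]`.
[cite: Mochizuki2012, IUTchIV Thm 1.10 proof Step (v) p. 27–28] [cite: DupuyHilado2025, §4.12] -/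
theorem readings_fail_thetaWeights_of_gt_of_tame (hj : 1 ≤ j)
    (hgt : -packetLogμ p (fun _ : Fin (j + 1) => 𝔽.k v) (integerPacket p (fun _ : Fin (j + 1) => 𝔽.k v) : Set _) +
        (dSum p (fun _ : Fin (j + 1) => 𝔽.k v) + 1) * Real.log p <
      ((j : ℝ) ^ 2 - 1) * (-Real.log ‖(q : 𝔽.k v)‖)) :
    ¬ VolumeReading p 𝔽 (fun _ : Fin (j + 1) => v) q B ∧
      ¬ SubsetReading p 𝔽 (fun _ : Fin (j + 1) => v) q B ∧
      ¬ MemReading p 𝔽 (fun _ : Fin (j + 1) => v) q B ∧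
      ¬ IsoReading p 𝔽 (fun _ : Fin (j + 1) => v) q B ∧
      ¬ IsoVolReading p 𝔽 (fun _ : Fin (j + 1) => v) q B := by
  haveI : Nonempty (Fin (j + 1)) := ⟨0⟩
  have hδ := packetLogμ_packetHull_logPacket_sub_eq_of_tame p (fun _ : Fin (j + 1) => 𝔽.k v) hp (fun _ => he)
  refine readings_fail_thetaWeights_of_gt v t q hθ B hB hB1 hj ∅ (fun i _ => he) ?_
  rw [Finset.card_empty, Nat.cast_zero, mul_zero, zero_div, add_zero, hδ]
  exact hgt

end TameDiagonal

end Summit.ABC.IUTFork.PacketReal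

end
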